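import Summits.Ventures.LatticeQCDFlow.Scaling.TiltedInnovations
import Summits.Ventures.LatticeQCDFlow.Scaling.ExtensiveSpecificHeatStaple

/-!
HONEST FRAMING: exact (Metropolis-corrected) sampling algorithms for lattice gauge theory; figures
of merit are autocorrelation/cost numbers at stated couplings and volumes; no continuum-physics
claim.

# PlaquetteSumStaple — WEIGHTED PLAQUETTE SUMS ALONG ONE-LINK FIBRES: OSCILLATION, SEPARATION OF
# LINKS WITH DISJOINT PLAQUETTE SETS, AND THE STAPLE FLOOR `A_{e⋆} Q_e P_a ≥ a_p² · Var_Haar(Re tr ρ)`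
# FOR EVERY PLAQUETTE `p` OF THE TORUS (lean-1 GEN-11, ours; part 3 of 5 of the defect
# specific-heat floor (DVF))

Venture-side (OURS). Cell `lqcd-flow` (pub-lqcd), unit `pub-lqcd-lean-1-g11`, 2026-08-23.  The
model-specific input of the series for WEIGHTED PLAQUETTE SUMS `P_a(U) = Σ_p a_p Re tr ρ(U_p)`
(`plaqSum`, part 1), any compact `G`, any continuous `ρ`, any weights:

* §1 along the `e`-fibre `P_a` changes only through the plaquettes through `e`
  (`plaqSum_mulSingle_sub_eq`), by at most `2N Σ_{p ∋ e} |a_p| ≤ 4N(d−1)·max|a|`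
  (`abs_plaqSum_mulSingle_sub_le`, `plaqSum_mulSingle_le_add`) — the ENGINE constant; two links with
  DISJOINT plaquette sets are SEPARATED by every `P_a` (`plaqSum_sep`) — the Bessel hypothesis.
* §2 torus geometry for an ARBITRARY plaquette `p = (y; i < j)` (item 126 did the plane `(0,1)`):
  its first link `e = (y, i)` and second ("staple") link `e⋆ = (y + eᵢ, j)` lie on no common
  plaquette other than `p` (`snd_not_mem_plaqEdgesT_of_ne`, `L ≥ 2`).
* §3 **THE STAPLE FLOOR** (`sq_mul_haarVar_le_linkAvg_sqDevT`): for EVERY configuration `U`,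
  `a_p² · Var_Haar(Re tr ρ) ≤ A_{e⋆} (Q_e P_a)(U)`: along the two-link fibre `(h, g)`,
  `P_a(h ·ₑ g ·_{e⋆} U) = A(h) + a_p Re tr ρ(h · U(e) g U(e)⁻¹ U_p) + c(g)`, and item 126's
  DECOUPLING LEMMA `staple_decoupling` (expand the square, Fubini, translation invariance of Haar)
  bounds the `g`-average of the `h`-variance below by the Haar variance of `a_p Re tr ρ`.

NOT CLAIMED: cross terms between different plaquettes through `e` (the floor keeps ONE plaquette
per link; no unitarity of `ρ` is needed); optimal constants.  Literature grade (cell rule): known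
mechanism (sublattice conditioning, Dobrushin–Tirozzi 1977); new typing only.
-/

noncomputable section

namespace Summit.Ventures.LatticeQCDFlow.Theory2.DefectFloor

open MeasureTheory ProbabilityTheory Literature.MathematicalPhysics.QuantumFieldTheory
open Summit.Ventures.LatticeQCDFlow.TrivializingMaps
open Summit.Ventures.LatticeQCDFlow.Theory2.ExtensiveSpecificHeat
open scoped ENNReal

/-! ## §1 Weighted plaquette sums along a one-link fibre -/

section Fibre

variable {d L N : ℕ} [NeZero L] {G : Type*} [Group G] [TopologicalSpace G] [IsTopologicalGroup G]
  [CompactSpace G] [MeasurableSpace G] [BorelSpace G] [SecondCountableTopology G]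
  [DecidableEq (Edge d L)] (ρ : G →* Matrix (Fin N) (Fin N) ℂ)

omit [TopologicalSpace G] [IsTopologicalGroup G] [CompactSpace G] [MeasurableSpace G] [BorelSpace G]
  [SecondCountableTopology G] in
/-- Replacing the link `e` changes `P_a` only through the plaquettes through `e`:
`P_a(h ·ₑ U) − P_a(U) = Σ_{p ∋ e} a_p (Re tr ρ((h ·ₑ U)_p) − Re tr ρ(U_p))`. -/
theorem plaqSum_mulSingle_sub_eq (a : Plaquette d L → ℝ) (e : Edge d L) (h : G)
    (U : GaugeConfig d L G) :
    plaqSum ρ a (Pi.mulSingle e h * U) - plaqSum ρ a U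
      = ∑ p ∈ plaqsThrough e,
          a p * (WilsonRP.plaqRe ρ (Pi.mulSingle e h * U) p - WilsonRP.plaqRe ρ U p) := by
  unfold plaqSum
  rw [← Finset.sum_sub_distrib]
  rw [← Finset.sum_subset (Finset.subset_univ (plaqsThrough e)) (fun p _ hp => by
    rw [WitnessColumn.plaqRe_mulSingle_of_not_mem ρ hp, sub_self])]
  exact Finset.sum_congr rfl fun p _ => by ring

omit [MeasurableSpace G] [BorelSpace G] [SecondCountableTopology G] in
/-- **Oscillation along a fibre**: `|P_a(h ·ₑ U) − P_a(U)| ≤ 2N Σ_{p ∋ e} |a_p|` (`|Re tr ρ| ≤ N`). -/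
theorem abs_plaqSum_mulSingle_sub_le (hρ : Continuous ρ) (a : Plaquette d L → ℝ) (e : Edge d L)
    (h : G) (U : GaugeConfig d L G) :
    |plaqSum ρ a (Pi.mulSingle e h * U) - plaqSum ρ a U|
      ≤ 2 * N * ∑ p ∈ plaqsThrough e, |a p| := by
  rw [plaqSum_mulSingle_sub_eq ρ a e h U, Finset.mul_sum]
  refine (Finset.abs_sum_le_sum_abs _ _).trans (Finset.sum_le_sum fun p _ => ?_)
  have ha := abs_le.1 (WilsonRP.abs_plaqRe_le ρ hρ U p)
  have hb := abs_le.1 (WilsonRP.abs_plaqRe_le ρ hρ (Pi.mulSingle e h * U) p)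
  rw [abs_mul]
  have h2 : |WilsonRP.plaqRe ρ (Pi.mulSingle e h * U) p - WilsonRP.plaqRe ρ U p| ≤ 2 * N :=
    abs_le.2 ⟨by linarith, by linarith⟩
  nlinarith [abs_nonneg (a p), abs_nonneg
    (WilsonRP.plaqRe ρ (Pi.mulSingle e h * U) p - WilsonRP.plaqRe ρ U p)]

omit [MeasurableSpace G] [BorelSpace G] [SecondCountableTopology G] in
/-- **Uniform oscillation**: if `|a_p| ≤ B` for all `p` (`B ≥ 0`), then
`|P_a(h ·ₑ U) − P_a(U)| ≤ 4N(d−1)·B` (a link lies on at most `2(d−1)` plaquettes). -/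
theorem abs_plaqSum_mulSingle_sub_le_of_bound (hρ : Continuous ρ) {a : Plaquette d L → ℝ} {B : ℝ}
    (hB0 : 0 ≤ B) (hB : ∀ p, |a p| ≤ B) (e : Edge d L) (h : G) (U : GaugeConfig d L G) :
    |plaqSum ρ a (Pi.mulSingle e h * U) - plaqSum ρ a U| ≤ 4 * N * ((d - 1 : ℕ) : ℝ) * B := by
  refine (abs_plaqSum_mulSingle_sub_le ρ hρ a e h U).trans ?_
  have hsum : ∑ p ∈ plaqsThrough e, |a p| ≤ ((plaqsThrough e).card : ℝ) * B := by
    have h := Finset.sum_le_sum (s := plaqsThrough e) fun p _ => hB p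
    rwa [Finset.sum_const, nsmul_eq_mul] at h
  have hcard : ((plaqsThrough e).card : ℝ) ≤ 2 * ((d - 1 : ℕ) : ℝ) := by
    exact_mod_cast card_plaqsThrough_le e
  calc 2 * (N : ℝ) * ∑ p ∈ plaqsThrough e, |a p|
      ≤ 2 * N * (((plaqsThrough e).card : ℝ) * B) :=
        mul_le_mul_of_nonneg_left hsum (by positivity)
    _ ≤ 2 * N * (2 * ((d - 1 : ℕ) : ℝ) * B) :=
        mul_le_mul_of_nonneg_left (mul_le_mul_of_nonneg_right hcard hB0) (by positivity)
    _ = 4 * N * ((d - 1 : ℕ) : ℝ) * B := by ring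

omit [MeasurableSpace G] [BorelSpace G] [SecondCountableTopology G] in
/-- The ENGINE hypothesis for `Φ = P_c` with `|c_p| ≤ B`: `P_c(h ·ₑ U) ≤ P_c(U) + 4N(d−1)·B`. -/
theorem plaqSum_mulSingle_le_add (hρ : Continuous ρ) {c : Plaquette d L → ℝ} {B : ℝ}
    (hB0 : 0 ≤ B) (hB : ∀ p, |c p| ≤ B) (e : Edge d L) (h : G) (U : GaugeConfig d L G) :
    plaqSum ρ c (Pi.mulSingle e h * U) ≤ plaqSum ρ c U + 4 * N * ((d - 1 : ℕ) : ℝ) * B := by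
  have := (abs_le.1 (abs_plaqSum_mulSingle_sub_le_of_bound ρ hρ hB0 hB e h U)).2
  linarith

/-- **SEPARATION.** Two different links with DISJOINT plaquette sets are separated by every
weighted plaquette sum: `P_a(h' ·_{e'} h ·ₑ U) = P_a(h' ·_{e'} U) + (P_a(h ·ₑ U) − P_a(U))`. -/
theorem plaqSum_sep {e e' : Edge d L} (hne : e ≠ e')
    (hdis : Disjoint (plaqsThrough e) (plaqsThrough e')) (a : Plaquette d L → ℝ) (h h' : G)
    (U : GaugeConfig d L G) :
    plaqSum ρ a (Pi.mulSingle e' h' * (Pi.mulSingle e h * U))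
      = plaqSum ρ a (Pi.mulSingle e' h' * U) + (plaqSum ρ a (Pi.mulSingle e h * U) - plaqSum ρ a U) := by
  rw [← mulSingle_comm_mul hne]
  have h1 := plaqSum_mulSingle_sub_eq ρ a e h (Pi.mulSingle e' h' * U)
  have h2 := plaqSum_mulSingle_sub_eq ρ a e h U
  have hsum : ∑ p ∈ plaqsThrough e,
        a p * (WilsonRP.plaqRe ρ (Pi.mulSingle e h * (Pi.mulSingle e' h' * U)) p
          - WilsonRP.plaqRe ρ (Pi.mulSingle e' h' * U) p)
      = ∑ p ∈ plaqsThrough e,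
          a p * (WilsonRP.plaqRe ρ (Pi.mulSingle e h * U) p - WilsonRP.plaqRe ρ U p) := by
    refine Finset.sum_congr rfl fun p hp => ?_
    have hp' : p ∉ plaqsThrough e' := Finset.disjoint_left.1 hdis hp
    rw [mulSingle_comm_mul hne, WitnessColumn.plaqRe_mulSingle_of_not_mem ρ hp',
      WitnessColumn.plaqRe_mulSingle_of_not_mem ρ hp']
  linarith [h1, h2, hsum]

/-- `h ↦ Re tr ρ((h ·ₑ U)_q)` is continuous. [folklore] -/
theorem continuous_plaqRe_mulSingle (hρ : Continuous ρ) (e : Edge d L) (U : GaugeConfig d L G)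
    (q : Plaquette d L) : Continuous fun h : G => WilsonRP.plaqRe ρ (Pi.mulSingle e h * U) q := by
  have h1 : Continuous fun V : GaugeConfig d L G => plaquetteHolonomy V q.1 q.2.1.1 q.2.1.2 := by
    unfold plaquetteHolonomy; fun_prop
  exact Complex.continuous_re.comp
    ((hρ.comp (h1.comp (continuous_mulSingle_mul e U))).matrix_trace)

end Fibre

/-! ## §2 Torus geometry: the first and the staple link of an arbitrary plaquette -/

section Geometry

variable {d L : ℕ} [NeZero L]

/-- A plaquette lies on its first link `(y, i)`. [folklore] -/
theorem self_mem_plaqsThrough_fst (p : Plaquette d L) :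
    p ∈ plaqsThrough ((p.1, p.2.1.1) : Edge d L) := by
  rw [mem_plaqsThrough]
  simp [plaqEdgesT]

omit [NeZero L] in
/-- For `L ≥ 2`, `(x + eᵢ) + eⱼ ≠ x` when `i ≠ j` (any dimension). [folklore] -/
theorem shift_shift_ne_self' (hL : 2 ≤ L) (x : Site d L) {i j : Fin d} (hij : i ≠ j) :
    (x.shift i).shift j ≠ x := by
  haveI : Fact (1 < L) := ⟨by omega⟩
  intro h
  have h1 := congrFun h i
  simp [Site.shift, hij] at h1

omit [NeZero L] in
/-- `Site.shift · i` is injective. [folklore] -/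
theorem shift_left_cancel {x y : Site d L} {i : Fin d} (h : x.shift i = y.shift i) : x = y := by
  simp only [Site.shift] at h
  exact add_right_cancel h

/-- **The staple link meets the first link only on `p`.**  For a plaquette `p = (y; i < j)` and any
plaquette `q ≠ p` through the first link `(y, i)` of `p`, the second link `(y + eᵢ, j)` of `p` is
NOT an edge of `q` (`L ≥ 2`). -/
theorem snd_not_mem_plaqEdgesT_of_ne (hL : 2 ≤ L) (p : Plaquette d L) {q : Plaquette d L}
    (hq : q ∈ plaqsThrough ((p.1, p.2.1.1) : Edge d L)) (hne : q ≠ p) :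
    ((p.1.shift p.2.1.1, p.2.1.2) : Edge d L) ∉ plaqEdgesT q := by
  obtain ⟨y, ⟨⟨i, j⟩, hij⟩⟩ := p
  obtain ⟨z, ⟨⟨a, b⟩, hab⟩⟩ := q
  have hij' : i < j := hij
  have hab' : a < b := hab
  have hijne : i ≠ j := ne_of_lt hij'
  rw [mem_plaqsThrough] at hq
  simp only [plaqEdgesT, Finset.mem_insert, Finset.mem_singleton, Prod.mk.injEq] at hq ⊢
  have hiv := Fin.lt_def.1 hij'
  have habv := Fin.lt_def.1 hab'
  -- the four ways `(y, i)` can be an edge of `q = (z; a < b)`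
  rcases hq with ⟨h1, h2⟩ | ⟨h1, h2⟩ | ⟨h1, h2⟩ | ⟨h1, h2⟩
  · -- `(y, i) = (z, a)`
    subst h1; subst h2
    rintro (⟨h3, h4⟩ | ⟨h3, h4⟩ | ⟨h3, h4⟩ | ⟨h3, h4⟩)
    · exact hijne h4.symm
    · exact hne (by subst h4; rfl)
    · exact hijne h4.symm
    · exact site_shift_ne_self_of_two_le hL y i h3
  · -- `(y, i) = (z + e_a, b)`: then `a < b = i < j`, so `j` is neither `a` nor `b`
    subst h2
    rintro (⟨h3, h4⟩ | ⟨h3, h4⟩ | ⟨h3, h4⟩ | ⟨h3, h4⟩)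
    · rw [h4] at hiv; omega
    · exact hijne h4.symm
    · rw [h4] at hiv; omega
    · exact hijne h4.symm
  · -- `(y, i) = (z + e_b, a)`: `a = i`, `y = z + e_b`
    subst h2
    rintro (⟨h3, h4⟩ | ⟨h3, h4⟩ | ⟨h3, h4⟩ | ⟨h3, h4⟩)
    · exact hijne h4.symm
    · -- `y + e_i = z + e_i` forces `y = z`, contradicting `y = z + e_b`
      have hyz : y = z := shift_left_cancel h3
      rw [hyz] at h1
      exact site_shift_ne_self_of_two_le hL z b h1.symm
    · exact hijne h4.symm
    · -- `y + e_i = z` and `y = z + e_b`: a double shift fixes `z`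
      subst h4
      rw [← h3] at h1
      exact shift_shift_ne_self' hL y hijne h1.symm
  · -- `(y, i) = (z, b)`: `b = i`, `a < i < j`
    subst h1; subst h2
    rintro (⟨h3, h4⟩ | ⟨h3, h4⟩ | ⟨h3, h4⟩ | ⟨h3, h4⟩)
    · rw [h4] at hiv; omega
    · exact hijne h4.symm
    · rw [h4] at hiv; omega
    · exact hijne h4.symm

/-- Equivalently: such a `q` is not a plaquette through the staple link. -/
theorem not_mem_plaqsThrough_snd_of_ne (hL : 2 ≤ L) (p : Plaquette d L) {q : Plaquette d L}
    (hq : q ∈ plaqsThrough ((p.1, p.2.1.1) : Edge d L)) (hne : q ≠ p) :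
    q ∉ plaqsThrough ((p.1.shift p.2.1.1, p.2.1.2) : Edge d L) := by
  rw [mem_plaqsThrough]
  exact snd_not_mem_plaqEdgesT_of_ne hL p hq hne

omit [NeZero L] in
/-- The first and the staple link of a plaquette are different links. [folklore] -/
theorem fst_ne_snd (p : Plaquette d L) :
    ((p.1, p.2.1.1) : Edge d L) ≠ (p.1.shift p.2.1.1, p.2.1.2) := fun h =>
  (ne_of_lt p.2.2) (congrArg Prod.snd h)

end Geometry

/-! ## §3 The staple floor for weighted plaquette sums -/

section Staple

variable {d L N : ℕ} [NeZero L] {G : Type*} [Group G] [TopologicalSpace G] [IsTopologicalGroup G]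
  [CompactSpace G] [MeasurableSpace G] [BorelSpace G] [SecondCountableTopology G]
  [DecidableEq (Edge d L)] (ρ : G →* Matrix (Fin N) (Fin N) ℂ)

/-- **THE STAPLE FLOOR (pointwise in the environment).**  For every plaquette `p` of the torus
(`L ≥ 2`), every weight `a` and EVERY configuration `U`: the Haar average over the staple link
`e⋆ = (y + eᵢ, j)` of the fibre variance of `P_a` along the first link `e = (y, i)` of `p = (y; i<j)`
is at least `a_p² · Var_Haar(Re tr ρ)`. -/
theorem sq_mul_haarVar_le_linkAvg_sqDevT (hL : 2 ≤ L) (hρ : Continuous ρ) (a : Plaquette d L → ℝ)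
    (p : Plaquette d L) (U : GaugeConfig d L G) :
    (a p) ^ 2 * ∫ g, ((ρ g).trace.re - ∫ g', (ρ g').trace.re ∂haarProbability G) ^ 2
        ∂haarProbability G
      ≤ linkAvg ((p.1.shift p.2.1.1, p.2.1.2) : Edge d L)
          (sqDevT ((p.1, p.2.1.1) : Edge d L) (plaqSum ρ a)) U := by
  set e : Edge d L := (p.1, p.2.1.1) with he
  set es : Edge d L := (p.1.shift p.2.1.1, p.2.1.2) with hes
  have hij : p.2.1.1 ≠ p.2.1.2 := ne_of_lt p.2.2
  have hne : e ≠ es := fst_ne_snd p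
  have hp0 : p ∈ plaqsThrough e := self_mem_plaqsThrough_fst p
  have hφ : Continuous fun m : G => -(a p) * (ρ m).trace.re :=
    continuous_const.mul (Complex.continuous_re.comp hρ.matrix_trace)
  -- the `h`-only part
  set A : G → ℝ := fun h => ∑ q ∈ (plaqsThrough e).erase p,
    a q * (WilsonRP.plaqRe ρ (Pi.mulSingle e h * U) q - WilsonRP.plaqRe ρ U q) with hA_def
  have hA : Continuous A := by
    refine continuous_finsetSum _ fun q _ => continuous_const.mul ?_
    exact (continuous_plaqRe_mulSingle ρ hρ e U q).sub continuous_const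
  -- the `g`-only part
  set c : G → ℝ := fun g => plaqSum ρ a (Pi.mulSingle es g * U)
    - a p * WilsonRP.plaqRe ρ (Pi.mulSingle es g * U) p with hc_def
  -- the additive decomposition `P_a(h ·ₑ g ·ₑ⋆ U) = A(h) − φ(h · a' g b') + c(g)`
  have hT : ∀ h g : G,
      plaqSum ρ a (Pi.mulSingle e h * (Pi.mulSingle es g * U))
      = A h - (-(a p) * (ρ (h * (U e * g * ((U e)⁻¹
          * plaquetteHolonomy U p.1 p.2.1.1 p.2.1.2)))).trace.re) + c g := by
    intro h g
    have hsub := plaqSum_mulSingle_sub_eq ρ a e h (Pi.mulSingle es g * U)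
    rw [← Finset.add_sum_erase _ _ hp0] at hsub
    have hA' : ∑ q ∈ (plaqsThrough e).erase p,
          a q * (WilsonRP.plaqRe ρ (Pi.mulSingle e h * (Pi.mulSingle es g * U)) q
            - WilsonRP.plaqRe ρ (Pi.mulSingle es g * U) q) = A h := by
      refine Finset.sum_congr rfl fun q hq => ?_
      obtain ⟨hqne, hqmem⟩ := Finset.mem_erase.1 hq
      have hns := not_mem_plaqsThrough_snd_of_ne hL p hqmem hqne
      rw [mulSingle_comm_mul hne, WitnessColumn.plaqRe_mulSingle_of_not_mem ρ hns,
        WitnessColumn.plaqRe_mulSingle_of_not_mem ρ hns]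
    have hP : WilsonRP.plaqRe ρ (Pi.mulSingle e h * (Pi.mulSingle es g * U)) p
        = (ρ (h * (U e * g * ((U e)⁻¹ * plaquetteHolonomy U p.1 p.2.1.1 p.2.1.2)))).trace.re := by
      simp only [WilsonRP.plaqRe, he, hes]
      rw [plaquetteHolonomy_mulSingle_left hL _ p.1 hij h,
        ExtensiveSpecificHeat.plaquetteHolonomy_mulSingle_second hL U p.1 hij g,
        mul_assoc (U (p.1, p.2.1.1) * g)]
    rw [hA', hP] at hsub
    simp only [hc_def]
    linarith [hsub]
  have key := staple_decoupling hA hφ (U e)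
    ((U e)⁻¹ * plaquetteHolonomy U p.1 p.2.1.1 p.2.1.2) hT
  -- the left side of `key` is `a_p² · Var_Haar(Re tr ρ)`
  have hlhs : ∫ g, (-(a p) * (ρ g).trace.re - ∫ g', -(a p) * (ρ g').trace.re ∂haarProbability G) ^ 2
        ∂haarProbability G
      = (a p) ^ 2 * ∫ g, ((ρ g).trace.re - ∫ g', (ρ g').trace.re ∂haarProbability G) ^ 2
          ∂haarProbability G := by
    rw [integral_const_mul, ← integral_const_mul ((a p) ^ 2)]
    refine integral_congr_ae (ae_of_all _ fun g => ?_)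
    ring
  rw [hlhs] at key
  unfold linkAvg sqDevT
  unfold linkAvg
  exact key

/-- **STAPLE FLOOR, integrated.**  For every probability measure `μ` on configurations:
`a_p² · Var_Haar(Re tr ρ) ≤ ∫ A_{e⋆} (Q_e P_a) dμ`. -/
theorem sq_mul_haarVar_le_integral_linkAvg_sqDevT (hL : 2 ≤ L) (hρ : Continuous ρ)
    (a : Plaquette d L → ℝ) (p : Plaquette d L) (μ : Measure (GaugeConfig d L G))
    [IsProbabilityMeasure μ] :
    (a p) ^ 2 * ∫ g, ((ρ g).trace.re - ∫ g', (ρ g').trace.re ∂haarProbability G) ^ 2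
        ∂haarProbability G
      ≤ ∫ U, linkAvg ((p.1.shift p.2.1.1, p.2.1.2) : Edge d L)
          (sqDevT ((p.1, p.2.1.1) : Edge d L) (plaqSum ρ a)) U ∂μ := by
  have hQ : Continuous (linkAvg ((p.1.shift p.2.1.1, p.2.1.2) : Edge d L)
      (sqDevT ((p.1, p.2.1.1) : Edge d L) (plaqSum (G := G) ρ a))) :=
    continuous_linkAvg _ (continuous_sqDevT _ (continuous_plaqSum ρ hρ a))
  have h := integral_mono (μ := μ) (integrable_const _) (integrable_of_continuous_config hQ)
    fun U => sq_mul_haarVar_le_linkAvg_sqDevT ρ hL hρ a p U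
  rwa [integral_const, smul_eq_mul, probReal_univ, one_mul] at h

end Staple

end Summit.Ventures.LatticeQCDFlow.Theory2.DefectFloor
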